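import Literature.MathematicalPhysics.QuantumFieldTheory.Balaban1983to89.B8Prop6DentedCubeMemberScalarGamma
import Literature.MathematicalPhysics.QuantumFieldTheory.Balaban1983to89.B8Real123DentedCubeMember
import Literature.MathematicalPhysics.QuantumFieldTheory.Balaban1983to89.B8Thm32GBoundCubeMemberHolds
import Literature.MathematicalPhysics.QuantumFieldTheory.Balaban1983to89.B8Ineq159FlatDentedCubeMemberSCGamma
import Literature.MathematicalPhysics.QuantumFieldTheory.Balaban1983to89.B8Ineq159FlatCubeMemberTransplant

/-!
# `Balaban1983to89.B8Prop6DentedCubeMemberScalarGammaOfNamedFacts` — [Balaban1985RegularSpaces] PROPOSITION 6 (p. 99) AS `Node00.GaugedBoundB8D` AT A DENTED CUBE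
# MEMBER OF PRINT's BIG-BLOCK SUB-LATTICE, FROM THE NAMED FACTS — THE (β) CROWN, EDITION γ

statement-level skeleton of published theorems with citation tags; proofs where landed; nothing here is a claim about the
Yang–Mills mass gap

PDF held: `paper:balaban1985-cmp99-regular-spaces-gauge-fixing`; pp. 98–99 (Prop. 6: «cubes □ ⊂ Ω_k^c of the cover», «□ intersecting Ω_j but not Ω_{j+1}»),
Thm 4 p. 88, Prop. 3 p. 87, (1.59) p. 86, (1.62) p. 87, (1.31) p. 82, (1.91)–(1.92) p. 91, (1.98) p. 92, (1.101) p. 93; `[Balaban1985Variational]` ("[15]") (148)–(152)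
p. 301, p. 300; [4] = `[Balaban1985BackgroundPropagators]` Thms 3.1–3.3 pp. 397–399; [B6] = `[Balaban1984PropagatorsII]` Prop. 2.3 p. 238, Prop. 2.6 (2.136) p. 247.

CITATION HEADER (lean-in-tree rule).  Cell `pub-ymgap` (HUMAN RULING D-0062, Track A), DAG node N05 = [B8], seat `pub-ymgap-dag-n05-e` (g31; FAN-OUT §N05 row s3b,
Proposition-6 lane; the (β) road of NODE 00's dented datum `Node00.CubeB8D ∕ GaugedBoundB8D`, p655171).  WHY THIS FILE.  The pure road is CLOSED in the tree:
`B8Prop6CubeMemberScalarGammaHolds.gaugedBoundB8_cubeMember_scalar_γ_holds` gives `Node00.GaugedBoundB8` at every PURE cube member of print's sub-lattice (odd `L ≥ 5`)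
from two analytic facts both PROVED for the pure member ((1.59)♭ `Ineq159FlatCubeMemberPrinted`, dag-n05-c's torus transplant; the 𝒢-bound ∕ REAL families,
dag-n05-c's `B8Thm32GBoundCubeMemberHolds`).  Print's Proposition 6 is stated for the DENTED members too («a cube □ intersecting Ω_j but not Ω_{j+1}», [15] (148)–(150):
`Ω′_j = □_j (j < k)`, `Ω′_k = □_k ∩ Ω_k`), which is what NODE 00's located carrier (dag-n07-e) consumes as `GaugedBoundB8D`.  This generation twinned the whole γ chain over
the dented member (p661581 `B8DentedCubeMemberZd`, p662157 `…LamBPrime`, p662540 `B8Prop6DentedCubeMemberGamma`, p663356 letters, p663396 Prop-5 laws, p664305 Fγ5,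
p664291 Fγ10a, p665103 ∕ (d3)-8 norms, (d3)-9 `…Gauged`, (d3)-10 Fγ6, (d3)-11 Fγ7 `gaugedBoundB8D_dentedMember_scalar_γ`).  THIS FILE is the crown: it feeds Fγ7-dented's
three displayed inputs BY NAME — (i) the SCALAR γ clauses from `B8Ineq159FlatDentedCubeMemberSCGamma.sc4_dented_of_ineq159Printed` (the pure named fact below the top,
the dented named fact `Ineq159FlatDentedCubeMemberPrinted` (p659892) at the top; split index via `lamBPF_sub_splitIndex`); (ii) the three REAL families: at the
truncations `n < k` — which ARE the pure member's (`CubeB8D.sq_of_lt`, `lamST_of_lt`) — from dag-n05-c's UNCONDITIONAL `prop6_real123_printed`, letter by letter; at the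
top truncation `n = k` from the named `B8Real123DentedCubeMember.Real123DentedCubeMemberPrinted` (this seat, (d3)-12); (iii) print's weights `wPrinted`.
★ `gaugedBoundB8D_dentedMember_scalar_γ_of_real123` (§1: scalar clauses displayed, REAL fed), ★★ `gaugedBoundB8D_dentedMember_scalar_γ_of_namedFacts` (§2: the three
named facts as hypotheses, print's p. 98 side conditions in the sub-lattice letters `M_h = Lˢ` plus the one dent premise «`Ω_k` a union of `L^{s+1}Lᵏ`-cubes of the grid
anchored at `□_k`'s corner» ([6] (1.4)₂)), ★★★ `gaugedBoundB8D_dentedMember_scalar_γ_of_dentedNamedFacts` (§3: the pure (1.59)♭ fact DISCHARGED by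
`ineq159FlatCubeMemberPrinted_holds` for odd `L ≥ 5` — `GaugedBoundB8D` at every dented member of the sub-lattice MODULO THE TWO DENTED NAMED FACTS).  Proofs =
the pure Fγ8 §1 ∕ Fγ10b ∕ `…Holds` compositions with the dented names; the only new step is the letter conversion `c.sq j = cubeFam false … j (j ≤ n < k)`.
Kind «kernel-checked proof», theorems only, no `def`.

HONEST SCOPE ∕ A6.  CONDITIONAL theorems: §3 rests on TWO OPEN named facts on the dented member — `Ineq159FlatDentedCubeMemberPrinted d L` ([4] Thm 3.3 at `U = 1` on
[15]'s `{Ω′_j}`, top truncation) and `Real123DentedCubeMemberPrinted (d−1) (L−1)` ([4] Thms 3.1–3.2 ∕ [B8] (1.91)–(1.92), (1.98), (1.101) there) — whose proofs are the dented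
twins of dag-n05-c's torus transplant and of the parametrix ∕ box-transfer files (not in the tree; the dented torus member `B8CubeMemberTorusDomainsDented` p659647 and the
dented 𝒢-bound name `GBoundDentedCubeMemberPrinted` p661669 are their prepared sockets).  By-name compositions; NO new estimate; nothing of [4]∕[6]∕[15] asserted as proved;
LOCATED-CARRIER caveat as in the pure crown (NODE 00's `CubeB8D` data ⊋ print's cubes; the sub-lattice side conditions select print's).  Count-neutral; N05 ∕ N07 NOT
discharged; FLAG №4 open; one finite `𝕋⁴` programme at fixed `ε`, Bałaban as printed; nothing continuum ∕ ℝ⁴ ∕ OS ∕ mass-gap ∕ Clay.  No `sorry`, no `def`, no `instance`,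
no `notation`.  Unit `pub-ymgap-dag-n05-e` (g31), 2026-08-28.

RELATED IN THE TREE, NOT DUPLICATED (`rg` 2026-08-28T20:45Z: `ls Balaban1983to89 | grep -ci 'DentedCubeMemberScalarGammaOf'` = 0): the pure models
`B8Prop6CubeMemberScalarGammaOfGBound` (Fγ8), `…OfIneq159Printed` (Fγ10b), `…Holds`; the inputs named above (all USED by name).
-/

noncomputable section

open NormedSpace

namespace Literature.MathematicalPhysics.QuantumFieldTheory.Balaban1983to89.B8Prop6DentedCubeMemberScalarGammaOfNamedFacts

open scoped Matrix
open B7Prop1Explicit B7Prop2Explicit B7Prop1Local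
open B7Prop4GeneralLevels (linCovIter)
open B8Ineq132 (covDerivFwd InAk BondTouches)
open B8Eq140Level (SideTouches)
open B8Eq143PlaqExpansion (pdiv)
open B8Eq146AExpansion (iEta plaqCovDeriv)
open B8Eq155JBound (Jcur wsup)
open B8ScaledSupNorm (bondNorm msup)
open B8Eq138LandauZd (IsLandau138 covLap)
open B8Eq131CubesAdmissible (cubeFam cubeFam_false_of_le)
open B8Eq1101CubeMemberWeights (wPrinted wPrinted_facts)
open B8Thm32GBoundCubeMemberHolds (prop6_real123_printed)
open B8Real123DentedCubeMember (Real123DentedCubeMemberPrinted)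
open B8Ineq159FlatCubeMemberPrinted (Ineq159FlatCubeMemberPrinted)
open B8Ineq159FlatDentedCubeMemberPrinted (Ineq159FlatDentedCubeMemberPrinted)
open B8Ineq159FlatDentedCubeMemberSCGamma (lamBPF_sub_splitIndex sc4_dented_of_ineq159Printed)
open B8Ineq159FlatCubeMemberTransplant (ineq159FlatCubeMemberPrinted_holds)
open B8DentedCubeMemberZd (lamST_of_lt lamST_top)
open B8Prop6DentedCubeMemberScalarGamma (gaugedBoundB8D_dentedMember_scalar_γ)
open B9SupplySockB9P3ZdBeta (CrossB)
open Node00 (CubeB8D GaugedBoundB8D)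
open Literature.MathematicalPhysics.QuantumLattice (blockMap)

export B7Prop1Explicit (Site)

variable {d : ℕ}

variable {𝔸 : Type} [CStarAlgebra 𝔸] [Nontrivial 𝔸]

/-! ## §1 `GaugedBoundB8D` at a dented member of the sub-lattice from the scalar γ clauses, the REAL families FED (pure below the top, named at the top) -/

open Classical in
/-- ★ **PROPOSITION 6 (p. 99), (1.135)–(1.138) AS `Node00.GaugedBoundB8D` AT A DENTED CUBE MEMBER OF PRINT's BIG-BLOCK SUB-LATTICE, FROM THE TWO SCALAR FLAT γ
CLAUSES — THE THREE REAL FAMILIES FED BY NAME** — (d3)-11's `gaugedBoundB8D_dentedMember_scalar_γ` with its weights instantiated at print's `wPrinted (d−1) (L−1) η` and its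
three REAL inequality families at every truncation `1 ≤ n ≤ k` DISCHARGED: for `n < k` the truncated dented tower `(c.sq ↾ n, c.lamST n)` IS the pure member's
(`CubeB8D.sq_of_lt`, `lamST_of_lt`), and dag-n05-c's UNCONDITIONAL `B8Thm32GBoundCubeMemberHolds.prop6_real123_printed` ((1.91)–(1.92), (1.101), (1.98) on the pure member)
serves letter by letter; for `n = k` the named `Real123DentedCubeMemberPrinted (d−1) (L−1)` (OPEN; [4] Thms 3.1–3.2 on [15]'s `{Ω′_j}`).  Print's p. 98 side conditions on
the datum (`M_h ≥ 3`, `M₀ ≤ L·M_h`, `M_hL ∣ c.ρ`, `M_hL ∣ c.M`, `R·M_hL ≤ c.ρ`, `2L ≤ R`, `N₀ + 1 ≤ R·L·M_h`, `ρ₀ ≤ c.ρ`) and the dent premise displayed; constants = maxima of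
the two sources.  CONDITIONAL on `hR` and on the displayed scalar clauses.
[cite: Balaban1985RegularSpaces, Prop. 6 (1.135)–(1.138) p.99, p.98, Thm 4 p.88, Prop. 3 p.87, (1.59) p.86, (1.31) p.82, (1.91)–(1.92) p.91, (1.98) p.92, (1.101) p.93; Balaban1985Variational, (148)–(152) p.301; Balaban1985BackgroundPropagators, Thm 3.2 (3.48) p.398, Thm 3.1 (3.47) p.398, Thm 3.3 p.399] -/
theorem gaugedBoundB8D_dentedMember_scalar_γ_of_real123 (hd2 : 2 ≤ d) {L : ℕ} (hL : 2 ≤ L) {B₀ Bbd : ℝ} (hB₀ : 0 < B₀)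
    (hB : 2 ≤ 5 * (d : ℝ) * L * B₀) (hBbd : 0 ≤ Bbd) (hBd : 4 * Bbd ≤ ((d : ℝ) * L - 1) * B₀)
    (hR : Real123DentedCubeMemberPrinted (d - 1) (L - 1)) :
    ∃ c₁ ρ₀ M₀ : ℝ, ∃ N₀ : ℕ, 0 < c₁ ∧ ∀ (η : ℝ), 0 < η → ∀ {K : ℕ} {Ω : ℕ → Set (Site d)} (c : CubeB8D d L K Ω),
      -- PRINT'S SIDE CONDITIONS (p. 98) on the cube datum, above threshold: big blocks `M_hL`, `ρ ≥ R·M_hL`, `M_hL ∣ ρ`, `M_hL ∣ M`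
      ∀ (Mh R : ℕ), 3 ≤ Mh → M₀ ≤ (L : ℝ) * Mh → Mh * L ∣ c.ρ → Mh * L ∣ c.M → R * (Mh * L) ≤ c.ρ → 2 * L ≤ R →
        N₀ + 1 ≤ R * (L * Mh) → ρ₀ ≤ (c.ρ : ℝ) →
      -- THE DENT PREMISE ([6] (1.4)₂): `Ω_k` is a union of cubes of side `M_hL^{k+1}` of the grid anchored at `□_k`'s fine lower corner `Lᵏ(c.a − c.ρ)`
      (∀ x y : Site d,
          blockMap (Mh * L ^ (c.k + 1)) (x - fun i => (L : ℤ) ^ c.k * (c.a i - c.ρ)) =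
            blockMap (Mh * L ^ (c.k + 1)) (y - fun i => (L : ℤ) ^ c.k * (c.a i - c.ρ)) → x ∈ Ω c.k → y ∈ Ω c.k) →
      -- THE SCALAR FLAT FOUR-LINE (1.59) CLAUSE OF PROPOSITION 3's FRAME at the cube's top truncation `c.k`: ℂ-valued bond functions in the
      -- flat Landau gauge on the collars of `{□_j}`, exterior-collar allowance on each line ([4] Thm 3.3 at `U = 1` for `G(1)`, `H(1)`, a priori)
      (∀ φ : Site d → Fin d → ℂ,
        IsLandau138 L c.k η (c.sq 0) c.lamS (1 : Site d → Fin d → ℂˣ) φ →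
        (∀ (y : Site d) (τ : Fin d), (∀ j, j ≤ c.k → ¬ SideTouches (c.sq j) y τ) → φ y τ = 0) →
        msup L c.k η (-(1 : ℝ)) (fun j (b : Site d × Fin d) => SideTouches (c.sq j) b.1 b.2) (fun b => φ b.1 b.2)
          ≤ B₀ * (bondNorm L c.k η (-(3 : ℝ)) c.sq (fun x μ => Jcur η (1 : Site d → Fin d → ℂˣ) φ μ x)
            + wsup 1 (fun p : {p : ℕ × (Site d × Fin d) // p.1 ≤ c.k ∧ (p.2 ∈ c.lamBPT c.k p.1 ∨ (p.1 = 0 ∧ CrossB (c.sq 0) p.2))} =>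
                linCovIter L (1 : Site d → Fin d → ℂˣ) (iEta η φ) p.1.1 p.1.2.1 p.1.2.2))
            + Bbd * msup L c.k η (-(1 : ℝ)) (fun j (b : Site d × Fin d) => j = 0 ∧ SideTouches (c.sq 0) b.1 b.2 ∧
                ¬ BondTouches (c.sq 0) b.1 b.2) (fun b => φ b.1 b.2) ∧
        msup L c.k η (-(2 : ℝ)) (fun j (t : Fin d × Fin d × Site d) => SideTouches (c.sq j) t.2.2 t.2.1)
            (fun t => covDerivFwd η (1 : Site d → Fin d → ℂˣ) t.1 (fun z => φ z t.2.1) t.2.2)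
          ≤ B₀ * (bondNorm L c.k η (-(3 : ℝ)) c.sq (fun x μ => Jcur η (1 : Site d → Fin d → ℂˣ) φ μ x)
            + wsup 1 (fun p : {p : ℕ × (Site d × Fin d) // p.1 ≤ c.k ∧ (p.2 ∈ c.lamBPT c.k p.1 ∨ (p.1 = 0 ∧ CrossB (c.sq 0) p.2))} =>
                linCovIter L (1 : Site d → Fin d → ℂˣ) (iEta η φ) p.1.1 p.1.2.1 p.1.2.2))
            + Bbd * msup L c.k η (-(1 : ℝ)) (fun j (b : Site d × Fin d) => j = 0 ∧ SideTouches (c.sq 0) b.1 b.2 ∧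
                ¬ BondTouches (c.sq 0) b.1 b.2) (fun b => φ b.1 b.2) ∧
        bondNorm L c.k η (-(3 : ℝ)) c.sq (fun x μ => pdiv η (1 : Site d → Fin d → ℂˣ) (plaqCovDeriv η (1 : Site d → Fin d → ℂˣ) φ) μ x)
          ≤ B₀ * (bondNorm L c.k η (-(3 : ℝ)) c.sq (fun x μ => Jcur η (1 : Site d → Fin d → ℂˣ) φ μ x)
            + wsup 1 (fun p : {p : ℕ × (Site d × Fin d) // p.1 ≤ c.k ∧ (p.2 ∈ c.lamBPT c.k p.1 ∨ (p.1 = 0 ∧ CrossB (c.sq 0) p.2))} =>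
                linCovIter L (1 : Site d → Fin d → ℂˣ) (iEta η φ) p.1.1 p.1.2.1 p.1.2.2))
            + Bbd * msup L c.k η (-(1 : ℝ)) (fun j (b : Site d × Fin d) => j = 0 ∧ SideTouches (c.sq 0) b.1 b.2 ∧
                ¬ BondTouches (c.sq 0) b.1 b.2) (fun b => φ b.1 b.2) ∧
        bondNorm L c.k η (-(3 : ℝ)) c.sq (fun x μ => covLap η (1 : Site d → Fin d → ℂˣ) (fun z => φ z μ) x)
          ≤ B₀ * (bondNorm L c.k η (-(3 : ℝ)) c.sq (fun x μ => Jcur η (1 : Site d → Fin d → ℂˣ) φ μ x)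
            + wsup 1 (fun p : {p : ℕ × (Site d × Fin d) // p.1 ≤ c.k ∧ (p.2 ∈ c.lamBPT c.k p.1 ∨ (p.1 = 0 ∧ CrossB (c.sq 0) p.2))} =>
                linCovIter L (1 : Site d → Fin d → ℂˣ) (iEta η φ) p.1.1 p.1.2.1 p.1.2.2))
            + Bbd * msup L c.k η (-(1 : ℝ)) (fun j (b : Site d × Fin d) => j = 0 ∧ SideTouches (c.sq 0) b.1 b.2 ∧
                ¬ BondTouches (c.sq 0) b.1 b.2) (fun b => φ b.1 b.2)) →
      ∀ (U₀ : Site d → Fin d → 𝔸ˣ), (∀ x κ, U₀ x κ ∈ unitaryUnits 𝔸) → ∀ (α₀ : ℝ), 0 < α₀ → InAk L K η α₀ Ω U₀ →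
      7 * d * (L : ℝ) ^ 2 * c.M * α₀ ≤ c₁ →
      -- THE SCALAR FLAT TWO-LINE (1.59) CLAUSE OF THEOREM 4's FRAME at every truncation `m ≤ c.k` (ℂ-valued, flat Landau gauge, collar allowance)
      (∀ m, 1 ≤ m → m ≤ c.k → ∀ φ : Site d → Fin d → ℂ,
        IsLandau138 L m η (c.sq 0) (c.lamST m) (1 : Site d → Fin d → ℂˣ) φ →
        (∀ (y : Site d) (τ : Fin d), (∀ j, j ≤ m → ¬ SideTouches (c.sq j) y τ) → φ y τ = 0) →
        msup L m η (-(1 : ℝ)) (fun j (b : Site d × Fin d) => SideTouches (c.sq j) b.1 b.2) (fun b => φ b.1 b.2)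
          ≤ B₀ * (bondNorm L m η (-(3 : ℝ)) c.sq (fun x μ => Jcur η (1 : Site d → Fin d → ℂˣ) φ μ x)
            + wsup 1 (fun p : {p : ℕ × (Site d × Fin d) // p.1 ≤ m ∧ (p.2 ∈ c.lamBPT m p.1 ∨ (p.1 = 0 ∧ CrossB (c.sq 0) p.2))} =>
                linCovIter L (1 : Site d → Fin d → ℂˣ) (iEta η φ) p.1.1 p.1.2.1 p.1.2.2))
            + Bbd * msup L m η (-(1 : ℝ)) (fun j (b : Site d × Fin d) => j = 0 ∧ SideTouches (c.sq 0) b.1 b.2 ∧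
                ¬ BondTouches (c.sq 0) b.1 b.2) (fun b => φ b.1 b.2) ∧
        msup L m η (-(2 : ℝ)) (fun j (t : Fin d × Fin d × Site d) => SideTouches (c.sq j) t.2.2 t.2.1)
            (fun t => covDerivFwd η (1 : Site d → Fin d → ℂˣ) t.1 (fun z => φ z t.2.1) t.2.2)
          ≤ B₀ * (bondNorm L m η (-(3 : ℝ)) c.sq (fun x μ => Jcur η (1 : Site d → Fin d → ℂˣ) φ μ x)
            + wsup 1 (fun p : {p : ℕ × (Site d × Fin d) // p.1 ≤ m ∧ (p.2 ∈ c.lamBPT m p.1 ∨ (p.1 = 0 ∧ CrossB (c.sq 0) p.2))} =>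
                linCovIter L (1 : Site d → Fin d → ℂˣ) (iEta η φ) p.1.1 p.1.2.1 p.1.2.2))
            + Bbd * msup L m η (-(1 : ℝ)) (fun j (b : Site d × Fin d) => j = 0 ∧ SideTouches (c.sq 0) b.1 b.2 ∧
                ¬ BondTouches (c.sq 0) b.1 b.2) (fun b => φ b.1 b.2)) →
      GaugedBoundB8D L η U₀ c (7 * d * (L : ℝ) ^ 2 * (5 * (d : ℝ) * L * B₀) * c.M * α₀) := by
  -- write `d = d' + 1`, `L = ℓ + 1` (dag-n05-c's convention)
  obtain ⟨d', rfl⟩ : ∃ d', d = d' + 1 := ⟨d - 1, by omega⟩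
  obtain ⟨ℓ, rfl⟩ : ∃ ℓ, L = ℓ + 1 := ⟨L - 1, by omega⟩
  have hℓ : 1 ≤ ℓ := by omega
  -- the PURE real families (dag-n05-c, unconditional) and the DENTED ones at the top (named)
  obtain ⟨BGp, BHp, B2p, BRp, ρ₁, M₁, N₁, hBGp, hBHp, hB2p, hBRp, -, -, RP⟩ := prop6_real123_printed d' ℓ hℓ
  have hR' : Real123DentedCubeMemberPrinted d' ℓ := hR
  obtain ⟨BGd, BHd, B2d, BRd, ρ₂, M₂, N₂, -, -, -, -, RD⟩ := hR'
  -- (d3)-11's constants: maxima of the two sources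
  have hBG : 0 < max BGp BGd := lt_max_of_lt_left hBGp
  have hBH : 0 < max BHp BHd := lt_max_of_lt_left hBHp
  have hB2 : 0 ≤ max B2p B2d := le_max_of_le_left hB2p
  have hBR : 0 ≤ max BRp BRd := le_max_of_le_left hBRp
  have hB₀' : 0 < 3 * (2 * ((d' + 1 : ℕ) : ℝ) * (((ℓ + 1 : ℕ) : ℝ)) ^ 2) * max BGp BGd * max BRp BRd + 1 := by positivity
  have hfree : 3 * (2 * ((d' + 1 : ℕ) : ℝ) * (((ℓ + 1 : ℕ) : ℝ)) ^ 2) * max BGp BGd * max BRp BRd ≤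
      3 * (2 * ((d' + 1 : ℕ) : ℝ) * (((ℓ + 1 : ℕ) : ℝ)) ^ 2) * max BGp BGd * max BRp BRd + 1 := by linarith
  have hC₂ : 2097152 * (((d' + 1 : ℕ) : ℝ) + 1) ^ 2 * (((ℓ + 1 : ℕ) : ℝ)) ^ 2 ≤ 2097152 * (((d' + 1 : ℕ) : ℝ) + 1) ^ 2 * (((ℓ + 1 : ℕ) : ℝ)) ^ 2 :=
    le_rfl
  obtain ⟨c₁, hc₁, G⟩ := gaugedBoundB8D_dentedMember_scalar_γ (𝔸 := 𝔸) hd2 hL hB₀ hB₀' hB hC₂ hBH hB2 hBG.le hBR hfree hBbd hBd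
  refine ⟨c₁, max ρ₁ ρ₂, max M₁ M₂, max N₁ N₂, hc₁, ?_⟩
  intro η hη K Ω c Mh R hMh hM0 hρd hMd hRρ hR2 hRN hρ0 hΩ SC4 U₀ hU₀ α₀ hα hAK hs SC2
  refine G η hη c SC4 U₀ hU₀ α₀ hα hAK hs (wPrinted d' ℓ η) (fun j => ((wPrinted_facts d' hℓ hη).1 j).le) ?_ SC2
  -- the REAL block of (d3)-11 at `w := wPrinted`
  intro n hn hnk S hS B hB Kf hKf T hT Q hQ
  have hρpos : 0 < c.ρ := lt_of_lt_of_le (by omega) c.L_le_ρ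
  have hM0' : max M₁ M₂ ≤ ((ℓ : ℝ) + 1) * Mh := by
    have : ((ℓ + 1 : ℕ) : ℝ) = (ℓ : ℝ) + 1 := by push_cast; ring
    rw [← this]; exact hM0
  have hM₁ : M₁ ≤ ((ℓ : ℝ) + 1) * Mh := (le_max_left _ _).trans hM0'
  have hM₂ : M₂ ≤ ((ℓ : ℝ) + 1) * Mh := (le_max_right _ _).trans hM0'
  have hN₁ : N₁ + 1 ≤ R * ((ℓ + 1) * Mh) := le_trans (Nat.succ_le_succ (le_max_left _ _)) hRN
  have hN₂ : N₂ + 1 ≤ R * ((ℓ + 1) * Mh) := le_trans (Nat.succ_le_succ (le_max_right _ _)) hRN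
  have hρ₁ : ρ₁ ≤ (c.ρ : ℝ) := (le_max_left _ _).trans hρ0
  have hρ₂ : ρ₂ ≤ (c.ρ : ℝ) := (le_max_right _ _).trans hρ0
  rcases lt_or_eq_of_le hnk with hlt | heq
  · -- `n < k`: the truncated dented tower is the PURE member's — dag-n05-c's theorem, letter by letter
    have hsqj : ∀ j, j ≤ n → c.sq j = cubeFam false (ℓ + 1) c.a c.M c.ρ c.k j := fun j hj => by
      rw [c.sq_of_lt (lt_of_le_of_lt hj hlt), cubeFam_false_of_le (ℓ + 1) c.a c.M c.ρ (hj.trans hnk)]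
    have hsq0 := hsqj 0 (Nat.zero_le n)
    rw [hsq0] at hS
    rw [lamST_of_lt c hlt] at hB hKf
    obtain ⟨P1, P2, P3⟩ := RP η hη Mh hMh hM₁ c.a c.M c.ρ c.k n R hn hnk hρd hMd hρpos hRρ hR2 hN₁ hρ₁ S hS B hB Kf hKf T hT Q hQ
    refine ⟨fun ρ' r hr hρ' φ hφ0 hφS => ?_, fun X s hs0 hXs φ hφ0 hφS => ?_, fun ρ' r hr hρ' j hj v hv => ?_⟩
    · obtain ⟨a1, a2⟩ := P1 ρ' r hr (fun j hj z hz => hρ' j hj z (by rw [hsqj j hj]; exact hz)) φ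
        (fun x hx => hφ0 x (by rw [hsq0]; exact hx)) hφS
      exact ⟨fun x => (a1 x).trans (mul_le_mul_of_nonneg_right (le_max_left _ _) hr),
        fun j hj p hp => (a2 j hj p (by rw [← hsqj j hj]; exact hp)).trans (mul_le_mul_of_nonneg_right (le_max_left _ _) hr)⟩
    · obtain ⟨f, g, Δ⟩ := P2 X s hs0 hXs φ (fun x hx => hφ0 x (by rw [hsq0]; exact hx)) hφS
      exact ⟨fun x => (f x).trans (mul_le_mul_of_nonneg_right (le_max_left _ _) hs0),
        fun j hj p hp => (g j hj p (by rw [← hsqj j hj]; exact hp)).trans (mul_le_mul_of_nonneg_right (le_max_left _ _) hs0),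
        fun j hj x hx => (Δ j hj x (by rw [← hsqj j hj]; exact hx)).trans (mul_le_mul_of_nonneg_right (le_max_left _ _) hs0)⟩
    · exact (P3 ρ' r hr (fun j' hj' z hz => hρ' j' hj' z (by rw [hsqj j' hj']; exact hz)) j hj v
        (by rw [← hsqj j hj]; exact hv)).trans (mul_le_mul_of_nonneg_right (le_max_left _ _) hr)
  · -- `n = k`: the DENTED named fact verbatim (cells `c.lamS = c.lamST c.k`)
    subst heq
    rw [lamST_top c] at hB hKf
    obtain ⟨P1, P2, P3⟩ := RD η hη Mh hMh hM₂ _ _ c R hρd hMd hRρ hR2 hN₂ hρ₂ hΩ S hS B hB Kf hKf T hT Q hQ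
    refine ⟨fun ρ' r hr hρ' φ hφ0 hφS => ?_, fun X s hs0 hXs φ hφ0 hφS => ?_, fun ρ' r hr hρ' j hj v hv => ?_⟩
    · obtain ⟨a1, a2⟩ := P1 ρ' r hr hρ' φ hφ0 hφS
      exact ⟨fun x => (a1 x).trans (mul_le_mul_of_nonneg_right (le_max_right _ _) hr),
        fun j hj p hp => (a2 j hj p hp).trans (mul_le_mul_of_nonneg_right (le_max_right _ _) hr)⟩
    · obtain ⟨f, g, Δ⟩ := P2 X s hs0 hXs φ hφ0 hφS
      exact ⟨fun x => (f x).trans (mul_le_mul_of_nonneg_right (le_max_right _ _) hs0),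
        fun j hj p hp => (g j hj p hp).trans (mul_le_mul_of_nonneg_right (le_max_right _ _) hs0),
        fun j hj x hx => (Δ j hj x hx).trans (mul_le_mul_of_nonneg_right (le_max_right _ _) hs0)⟩
    · exact (P3 ρ' r hr hρ' j hj v hv).trans (mul_le_mul_of_nonneg_right (le_max_right _ _) hr)

#print axioms gaugedBoundB8D_dentedMember_scalar_γ_of_real123

/-! ## §2 The crown: `GaugedBoundB8D` at a dented member of the sub-lattice from the THREE NAMED FACTS -/

open Classical in
/-- ★★ **PROPOSITION 6 (p. 99), (1.135)–(1.138) AS `Node00.GaugedBoundB8D` AT EVERY DENTED CUBE MEMBER OF PRINT's BIG-BLOCK SUB-LATTICE, FROM THE NAMED FLAT FACTS.**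
There are `B₀ ≥ 1`, `c₁ > 0` and thresholds `ρ₀, M₀, N₀, R₀` such that for every `η > 0`, every dented cube datum `c : CubeB8D d L K Ω` ([15] (148)–(150)) on print's
p. 98 sub-lattice above threshold (`M_h = Lˢ ≥ 3`, `M₀ ≤ L^{s+1}`, `L^{s+1} ∣ ρ`, `L^{s+1} ∣ M`, `R·L^{s+1} ≤ ρ`, `2L ≤ R`, `R₀ ≤ R`, `N₀ + 1 ≤ R·L^{s+1}`, `ρ₀ ≤ ρ`) whose
ambient top member `Ω_k` is a union of `L^{s+1}Lᵏ`-cubes of the grid anchored at `□_k`'s corner ((1.4)₂), every unitary `U₀ ∈ 𝔄_K({Ω_j}, α₀)` with `7dL²Mα₀ ≤ c₁`: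
`GaugedBoundB8D L η U₀ c (7dL²·5dLB₀·Mα₀)` — Proposition 6's gauge `u` on `□̃`, the Landau gauge (1.138) at background `1` over the dented tower `{Ω′_j}`, (1.136)₁–₄
with print's constant shape.  HYPOTHESES (three named facts): the pure `h159 : Ineq159FlatCubeMemberPrinted d L` ((1.59) at `U₀ = 1` on the pure member — PROVED in the
tree for odd `L ≥ 5`, see §3), the dented `h159D : Ineq159FlatDentedCubeMemberPrinted d L` (top truncation of `{Ω′_j}`; OPEN) and `hR : Real123DentedCubeMemberPrinted
(d−1) (L−1)` ((1.91)–(1.92), (1.98), (1.101) at the top truncation of `{Ω′_j}`; OPEN); window `5 ≤ d·L`.  Composition: `sc4_dented_of_ineq159Printed` at the datum with the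
flat line's split index (`lamBPF_sub_splitIndex`; SC4γ at `m = k`, the first two lines at every `1 ≤ m ≤ k`) into §1 at `M_h := Lˢ`.
[cite: Balaban1985RegularSpaces, Prop. 6 (1.135)–(1.138) p.99, p.98, Thm 4 p.88, Prop. 3 p.87, (1.59) p.86, (1.62) p.87, (1.31) p.82, (1.91)–(1.92) p.91, (1.98) p.92, (1.101) p.93, (1.4) p.77; Balaban1985Variational, (148)–(152) p.301, p.300; Balaban1985BackgroundPropagators, Thm 3.3 p.399, Thm 3.2 (3.48) p.398, Thm 3.1 (3.47) p.398; Balaban1984PropagatorsII, Prop. 2.6 (2.136) p.247, Prop. 2.3 (2.87) p.238] -/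
theorem gaugedBoundB8D_dentedMember_scalar_γ_of_namedFacts (hd2 : 2 ≤ d) {L : ℕ} (hL : 2 ≤ L) (hdL : 5 ≤ d * L)
    (h159 : Ineq159FlatCubeMemberPrinted d L) (h159D : Ineq159FlatDentedCubeMemberPrinted d L)
    (hR : Real123DentedCubeMemberPrinted (d - 1) (L - 1)) :
    ∃ B₀ c₁ ρ₀ M₀ : ℝ, ∃ N₀ R₀ : ℕ, 1 ≤ B₀ ∧ 0 < c₁ ∧ ∀ (η : ℝ), 0 < η → ∀ {K : ℕ} {Ω : ℕ → Set (Site d)} (c : CubeB8D d L K Ω),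
      -- PRINT'S SIDE CONDITIONS (p. 98) on the cube datum in the named facts' letters (`M_h = Lˢ`), above threshold
      ∀ (s R : ℕ), 3 ≤ L ^ s → M₀ ≤ (L : ℝ) ^ (s + 1) → L ^ (s + 1) ∣ c.ρ → L ^ (s + 1) ∣ c.M → R * L ^ (s + 1) ≤ c.ρ → 2 * L ≤ R →
        R₀ ≤ R → N₀ + 1 ≤ R * L ^ (s + 1) → ρ₀ ≤ (c.ρ : ℝ) →
      -- THE DENT PREMISE ([6] (1.4)₂): `Ω_k` is a union of cubes of side `L^{s+1}Lᵏ` of the grid anchored at `□_k`'s fine lower corner `Lᵏ(c.a − c.ρ)`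
      (∀ x y : Site d,
          blockMap (L ^ (s + 1) * L ^ c.k) (x - fun i => (L : ℤ) ^ c.k * (c.a i - c.ρ)) =
            blockMap (L ^ (s + 1) * L ^ c.k) (y - fun i => (L : ℤ) ^ c.k * (c.a i - c.ρ)) → x ∈ Ω c.k → y ∈ Ω c.k) →
      ∀ (U₀ : Site d → Fin d → 𝔸ˣ), (∀ x κ, U₀ x κ ∈ unitaryUnits 𝔸) → ∀ (α₀ : ℝ), 0 < α₀ → InAk L K η α₀ Ω U₀ →
      7 * d * (L : ℝ) ^ 2 * c.M * α₀ ≤ c₁ →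
      GaugedBoundB8D L η U₀ c (7 * d * (L : ℝ) ^ 2 * (5 * (d : ℝ) * L * B₀) * c.M * α₀) := by
  have hL1 : 1 ≤ L := le_trans (by norm_num) hL
  obtain ⟨B₀, ρ₀, M₀, N₀, R₀, hB₀, SC⟩ := sc4_dented_of_ineq159Printed hd2 hL1 h159 h159D
  have hB₀pos : 0 < B₀ := lt_of_lt_of_le one_pos hB₀
  have hdr : (2 : ℝ) ≤ d := by exact_mod_cast hd2
  have hLr : (2 : ℝ) ≤ L := by exact_mod_cast hL
  have hdLr : (5 : ℝ) ≤ (d : ℝ) * L := by exact_mod_cast hdL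
  have hB : 2 ≤ 5 * (d : ℝ) * L * B₀ := by nlinarith [hB₀, hdr, hLr]
  have hBd : 4 * B₀ ≤ ((d : ℝ) * L - 1) * B₀ := by nlinarith [hB₀, hdLr]
  obtain ⟨c₁, ρ₁, M₁, N₁, hc₁, P6⟩ := gaugedBoundB8D_dentedMember_scalar_γ_of_real123 (𝔸 := 𝔸) hd2 hL hB₀pos hB hB₀pos.le hBd hR
  refine ⟨B₀, c₁, max ρ₀ ρ₁, max M₀ M₁, max N₀ N₁, R₀, hB₀, hc₁, ?_⟩
  intro η hη K Ω c s R hMh hM₀ hdρ hdM hRρ h2L hR₀ hN₀ hρ₀ hΩ U₀ hU₀ α₀ hα hA hs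
  have hk : 1 ≤ c.k := c.one_le_k
  -- print's side conditions in §1's letters (`M_h := Lˢ`)
  have hMhL : L ^ s * L = L ^ (s + 1) := (pow_succ L s).symm
  have hLMh : L * L ^ s = L ^ (s + 1) := by rw [mul_comm]; exact hMhL
  have hM₁ : M₁ ≤ (L : ℝ) * (L ^ s : ℕ) := by
    have : ((L : ℝ) * (L ^ s : ℕ)) = (L : ℝ) ^ (s + 1) := by push_cast; ring
    rw [this]; exact (le_max_right _ _).trans hM₀
  have hM₀' : M₀ ≤ (L : ℝ) ^ (s + 1) := (le_max_left _ _).trans hM₀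
  have hN₁ : N₁ + 1 ≤ R * (L * L ^ s) := by rw [hLMh]; exact le_trans (Nat.succ_le_succ (le_max_right _ _)) hN₀
  have hN₀' : N₀ + 1 ≤ R * L ^ (s + 1) := le_trans (Nat.succ_le_succ (le_max_left _ _)) hN₀
  have hρ₁ : ρ₁ ≤ (c.ρ : ℝ) := (le_max_right _ _).trans hρ₀
  have hρ₀' : ρ₀ ≤ (c.ρ : ℝ) := (le_max_left _ _).trans hρ₀
  -- the dent premise in §1's letters (`Lˢ·L^{k+1} = L^{s+1}·Lᵏ`)
  have hpow : L ^ s * L ^ (c.k + 1) = L ^ (s + 1) * L ^ c.k := by ring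
  have hΩ' : ∀ x y : Site d, blockMap (L ^ s * L ^ (c.k + 1)) (x - fun i => (L : ℤ) ^ c.k * (c.a i - c.ρ)) =
      blockMap (L ^ s * L ^ (c.k + 1)) (y - fun i => (L : ℤ) ^ c.k * (c.a i - c.ρ)) → x ∈ Ω c.k → y ∈ Ω c.k := by
    rw [hpow]; exact hΩ
  -- the SCALAR γ clauses at this datum from the two named facts, in the flat line's split index
  have S := fun m (hm1 : 1 ≤ m) (hmk : m ≤ c.k) =>
    SC η hη c s R hM₀' hdρ hdM hRρ hR₀ hN₀' hρ₀' hΩ m hm1 hmk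
      (fun j b => b ∈ c.lamBPT m j ∨ (j = 0 ∧ CrossB (c.sq 0) b)) (lamBPF_sub_splitIndex c hL1 hm1 hmk)
  exact P6 η hη c (L ^ s) R hMh hM₁ (by rw [hMhL]; exact hdρ) (by rw [hMhL]; exact hdM) (by rw [hMhL]; exact hRρ) h2L hN₁ hρ₁ hΩ'
    (fun φ hLan hsupp => S c.k hk le_rfl φ (by rw [lamST_top c]; exact hLan) hsupp) U₀ hU₀ α₀ hα hA hs
    (fun m hm1 hmk φ hLan hsupp => ⟨(S m hm1 hmk φ hLan hsupp).1, (S m hm1 hmk φ hLan hsupp).2.1⟩)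

#print axioms gaugedBoundB8D_dentedMember_scalar_γ_of_namedFacts

/-! ## §3 The same with the PURE flat fact discharged (odd `L ≥ 5`): `GaugedBoundB8D` at every dented member MODULO THE TWO DENTED NAMED FACTS -/

open Classical in
/-- ★★★ **PROPOSITION 6 (p. 99) AS `Node00.GaugedBoundB8D` AT EVERY DENTED CUBE MEMBER OF PRINT's BIG-BLOCK SUB-LATTICE, FOR ODD `L ≥ 5` AND `d ≥ 2`, MODULO THE
TWO DENTED NAMED FACTS** — §2 with its pure hypothesis `Ineq159FlatCubeMemberPrinted d L` DISCHARGED by dag-n05-c's torus transplant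
`B8Ineq159FlatCubeMemberTransplant.ineq159FlatCubeMemberPrinted_holds` ([4] Thm 3.3 at `U = 1` on the pure member by exact transfer to lit-balaban's multi-level torus
estimates; odd `L ≥ 5`).  REMAINING HYPOTHESES, both OPEN named facts on [15]'s dented sequence `{Ω′_j}` at its top truncation: `Ineq159FlatDentedCubeMemberPrinted d L`
(p659892) and `Real123DentedCubeMemberPrinted (d−1) (L−1)` ((d3)-12).  The dented twin of the pure UNCONDITIONAL crown
`B8Prop6CubeMemberScalarGammaHolds.gaugedBoundB8_cubeMember_scalar_γ_holds`.
[cite: Balaban1985RegularSpaces, Prop. 6 (1.135)–(1.138) p.99, p.98, (1.59) p.86, (1.91)–(1.92) p.91, (1.98) p.92, (1.101) p.93; Balaban1985Variational, (148)–(152) p.301; Balaban1985BackgroundPropagators, Thms 3.1–3.3 pp.398–399; Balaban1984PropagatorsII, Prop. 2.6 (2.136) p.247] -/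
theorem gaugedBoundB8D_dentedMember_scalar_γ_of_dentedNamedFacts (hd2 : 2 ≤ d) {L : ℕ} (hL5 : 5 ≤ L) (hodd : Odd L)
    (h159D : Ineq159FlatDentedCubeMemberPrinted d L) (hR : Real123DentedCubeMemberPrinted (d - 1) (L - 1)) :
    ∃ B₀ c₁ ρ₀ M₀ : ℝ, ∃ N₀ R₀ : ℕ, 1 ≤ B₀ ∧ 0 < c₁ ∧ ∀ (η : ℝ), 0 < η → ∀ {K : ℕ} {Ω : ℕ → Set (Site d)} (c : CubeB8D d L K Ω),
      -- PRINT'S SIDE CONDITIONS (p. 98) on the cube datum in the named facts' letters (`M_h = Lˢ`), above threshold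
      ∀ (s R : ℕ), 3 ≤ L ^ s → M₀ ≤ (L : ℝ) ^ (s + 1) → L ^ (s + 1) ∣ c.ρ → L ^ (s + 1) ∣ c.M → R * L ^ (s + 1) ≤ c.ρ → 2 * L ≤ R →
        R₀ ≤ R → N₀ + 1 ≤ R * L ^ (s + 1) → ρ₀ ≤ (c.ρ : ℝ) →
      -- THE DENT PREMISE ([6] (1.4)₂): `Ω_k` is a union of cubes of side `L^{s+1}Lᵏ` of the grid anchored at `□_k`'s fine lower corner `Lᵏ(c.a − c.ρ)`
      (∀ x y : Site d,
          blockMap (L ^ (s + 1) * L ^ c.k) (x - fun i => (L : ℤ) ^ c.k * (c.a i - c.ρ)) =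
            blockMap (L ^ (s + 1) * L ^ c.k) (y - fun i => (L : ℤ) ^ c.k * (c.a i - c.ρ)) → x ∈ Ω c.k → y ∈ Ω c.k) →
      ∀ (U₀ : Site d → Fin d → 𝔸ˣ), (∀ x κ, U₀ x κ ∈ unitaryUnits 𝔸) → ∀ (α₀ : ℝ), 0 < α₀ → InAk L K η α₀ Ω U₀ →
      7 * d * (L : ℝ) ^ 2 * c.M * α₀ ≤ c₁ →
      GaugedBoundB8D L η U₀ c (7 * d * (L : ℝ) ^ 2 * (5 * (d : ℝ) * L * B₀) * c.M * α₀) := by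
  obtain ⟨d', rfl⟩ : ∃ d', d = d' + 1 := ⟨d - 1, by omega⟩
  obtain ⟨ℓ, rfl⟩ : ∃ ℓ, L = ℓ + 1 := ⟨L - 1, by omega⟩
  have hL : 2 ≤ ℓ + 1 := by omega
  have hdL : 5 ≤ (d' + 1) * (ℓ + 1) := le_trans hL5 (Nat.le_mul_of_pos_left _ (Nat.succ_pos d'))
  exact gaugedBoundB8D_dentedMember_scalar_γ_of_namedFacts (𝔸 := 𝔸) hd2 hL hdL (ineq159FlatCubeMemberPrinted_holds d' ℓ (by omega) hodd) h159D hR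

#print axioms gaugedBoundB8D_dentedMember_scalar_γ_of_dentedNamedFacts

end Literature.MathematicalPhysics.QuantumFieldTheory.Balaban1983to89.B8Prop6DentedCubeMemberScalarGammaOfNamedFacts

end
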